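import Summits.NavierStokesRegularity.NavierStokesRegularity.Theorems.SoloSalvageWu2026Scaling
import Literature.Analysis.FunctionSpaces.WeakLpQuantitative
import Mathlib.MeasureTheory.Integral.MeanInequalities
import HarnessLib

/-!
# C177 `Wu2026` — SALVAGE, TRUE column: the scale-invariant annular current bound and the uniform
# Abel tail (3.73)–(3.78) (D-0090 NS-CLAIMS, LADDER row rung 3; salvage seat `ns-claims-salvage-p3`)

Second helper toward the binder `Literature.Claims.NS.Wu2026.Step_385` ((3.83)–(3.85) p.25–26).
The print (p.24 l.1–90) bounds the energy current on dyadic annuli by Hölder against the annular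
bounds (3.18)/(3.42) and sums dyadically: `∫_{A_L}|𝒬v| ≤ CL` (3.73), `R∫_{|x|>R}|𝒬v|/|x|² ≤ C`
(3.74), and — «the same calculation is uniform for the blow-down sequence» — the Abel tail
`sup_j ∫_{|y|>L} |Q_jV_j|/|y|² ≤ C/L` (3.78). Here, with WEAK data only (`q = p − c ∈ L^{9/4,∞}` and
`𝒬 = q + |v|²/2 ∈ L^{9/4,∞}`, i.e. the skeleton's `Tangent.weakP`; then `|v|² = 2𝒬 − 2q` is
controlled too, so `v ∈ L^{9/2,∞}` is never named):

* `setLIntegral_enorm_le_of_weak`, `setLIntegral_enorm_sq_le_of_weak` — the quantitative layer cake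
  (`MemWeakLp.setLIntegral_rpow_le`) on balls at height `r^{−4/3}`: `∫_{B̄_r}|f| ≤ K r^{5/3}`,
  `∫_{B̄_r}|f|² ≤ K' r^{1/3}` for `f ∈ L^{9/4,∞}`;
* `setLIntegral_normSq_le_of_bern` — `∫_{B̄_r}|v|² ≤ K'' r^{5/3}` from `|v|² ≤ 2|𝒬| + 2|q|`;
* `setLIntegral_bern_mul_norm_le` — Cauchy–Schwarz: `∫_{B̄_r}|𝒬||v| ≤ A·r` (**(3.73)**, scale-invariant);
* `lintegral_exterior_mul_inv_sq_le` — the quantitative SHELL LEMMA: ball bounds `∫_{B̄_r}F ≤ A r`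
  give `∫_{|x|>ρ} F|x|⁻² ≤ 4A/ρ` for every `ρ > 0` (dyadic shells, `Σ 2^{−k} = 2`) (**(3.74)**);
* `exists_physical_tail_le` — `ρ∫_{|x|>ρ}|𝒬||v||x|⁻² ≤ 4A` uniformly in `ρ > 0`;
* `exists_rescaled_tail_le` — **(3.78)**: `∫_{|y|>L}|Q_R||V_R||y|⁻² ≤ 4A/L` for every `R > 0`,
  `L > 0`, by the exact scaling `lintegral_tail_blowDown` of `SoloSalvageWu2026Scaling`.

Theorems only, standard axioms, no `sorry`.

WHAT THIS IS NOT: not a claim about NS regularity or blow-up; not a claim about any author beyond the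
typed locator.
-/

set_option linter.dupNamespace false

noncomputable section

open MeasureTheory Set Filter Topology Module Metric
open scoped ENNReal NNReal Topology RealInnerProductSpace

namespace Summit.NavierStokesRegularity.NavierStokesRegularity.Theorems.Wu2026Salvage

open Literature.Analysis.FluidPDE Literature.Analysis.FunctionSpaces Literature.Claims.NS.Wu2026

/-! ## Weak-`L^{9/4}` functions on balls -/

/-- `(9/4 : ℝ≥0∞).toReal = 9/4`. [folklore] -/
theorem toReal_nine_fourths : ((9 : ℝ≥0∞) / 4).toReal = 9 / 4 := by
  rw [ENNReal.toReal_div]; norm_num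

/-- `|B̄_r| = r³|B₁|` in `ℝ³`. [folklore] -/
theorem volume_closedBall_eq_E3 {r : ℝ} (hr : 0 ≤ r) :
    volume (closedBall (0 : E3) r) = ENNReal.ofReal (r ^ 3) * volume (ball (0 : E3) 1) := by
  rw [Measure.addHaar_closedBall volume (0 : E3) hr, finrank_euclideanSpace, Fintype.card_fin]

/-- First moment of a weak-`L^{9/4}` function on a ball (layer cake at height `r^{−4/3}`):
`∫_{B̄_r}|f| ≤ (|B₁| + (4/5)‖f‖^{9/4}_{9/4,∞}) r^{5/3}`. [cite: Wu2026, (3.42) p.15 (scaled form (3.76) p.24)] -/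
theorem setLIntegral_enorm_le_of_weak {f : E3 → ℝ} (hf : AEStronglyMeasurable f volume) {r : ℝ}
    (hr : 0 < r) :
    ∫⁻ x in closedBall (0 : E3) r, ‖f x‖ₑ ≤
      (volume (ball (0 : E3) 1) + ENNReal.ofReal (4 / 5) * eWeakLpPow f ((9 : ℝ≥0∞) / 4) volume) *
        ENNReal.ofReal (r ^ ((5 : ℝ) / 3)) := by
  set W : ℝ≥0∞ := eWeakLpPow f ((9 : ℝ≥0∞) / 4) volume with hW
  set V1 : ℝ≥0∞ := volume (ball (0 : E3) 1) with hV1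
  have h := MemWeakLp.setLIntegral_rpow_le (p := (9 : ℝ≥0∞) / 4) hf (r := 1) one_pos
    (by rw [toReal_nine_fourths]; norm_num) (closedBall (0 : E3) r) (lam := r ^ (-(4 : ℝ) / 3))
    (Real.rpow_pos_of_pos hr _)
  rw [toReal_nine_fourths] at h
  simp only [ENNReal.rpow_one, Real.rpow_one] at h
  refine h.trans (le_of_eq ?_)
  rw [volume_closedBall_eq_E3 hr.le, ← hV1, ← hW]
  have e1 : r ^ 3 * r ^ (-(4 : ℝ) / 3) = r ^ ((5 : ℝ) / 3) := by
    rw [← Real.rpow_natCast, ← Real.rpow_add hr]; norm_num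
  have e2 : (1 : ℝ) / (9 / 4 - 1) * (r ^ (-(4 : ℝ) / 3)) ^ ((1 : ℝ) - 9 / 4) = 4 / 5 * r ^ ((5 : ℝ) / 3) := by
    rw [← Real.rpow_mul hr.le]; norm_num
  rw [e2, ENNReal.ofReal_mul (by norm_num : (0 : ℝ) ≤ 4 / 5)]
  calc ENNReal.ofReal (r ^ 3) * V1 * ENNReal.ofReal (r ^ (-(4 : ℝ) / 3)) +
        ENNReal.ofReal (4 / 5) * ENNReal.ofReal (r ^ ((5 : ℝ) / 3)) * W
      = V1 * (ENNReal.ofReal (r ^ 3) * ENNReal.ofReal (r ^ (-(4 : ℝ) / 3))) +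
        ENNReal.ofReal (4 / 5) * W * ENNReal.ofReal (r ^ ((5 : ℝ) / 3)) := by ring
    _ = (V1 + ENNReal.ofReal (4 / 5) * W) * ENNReal.ofReal (r ^ ((5 : ℝ) / 3)) := by
        rw [← ENNReal.ofReal_mul (by positivity), e1]; ring

/-- Second moment of a weak-`L^{9/4}` function on a ball (layer cake at height `r^{−4/3}`):
`∫_{B̄_r}|f|² ≤ (|B₁| + 8‖f‖^{9/4}_{9/4,∞}) r^{1/3}`. [cite: Wu2026, (3.42) p.15 (scaled form (3.76) p.24)] -/
theorem setLIntegral_enorm_sq_le_of_weak {f : E3 → ℝ} (hf : AEStronglyMeasurable f volume)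
    {r : ℝ} (hr : 0 < r) :
    ∫⁻ x in closedBall (0 : E3) r, ‖f x‖ₑ ^ (2 : ℝ) ≤
      (volume (ball (0 : E3) 1) + ENNReal.ofReal 8 * eWeakLpPow f ((9 : ℝ≥0∞) / 4) volume) *
        ENNReal.ofReal (r ^ ((1 : ℝ) / 3)) := by
  set W : ℝ≥0∞ := eWeakLpPow f ((9 : ℝ≥0∞) / 4) volume with hW
  set V1 : ℝ≥0∞ := volume (ball (0 : E3) 1) with hV1
  have h := MemWeakLp.setLIntegral_rpow_le (p := (9 : ℝ≥0∞) / 4) hf (r := 2) two_pos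
    (by rw [toReal_nine_fourths]; norm_num) (closedBall (0 : E3) r) (lam := r ^ (-(4 : ℝ) / 3))
    (Real.rpow_pos_of_pos hr _)
  rw [toReal_nine_fourths] at h
  refine h.trans (le_of_eq ?_)
  rw [volume_closedBall_eq_E3 hr.le, ← hV1, ← hW]
  have e1 : r ^ 3 * (r ^ (-(4 : ℝ) / 3)) ^ (2 : ℝ) = r ^ ((1 : ℝ) / 3) := by
    rw [← Real.rpow_mul hr.le, ← Real.rpow_natCast, ← Real.rpow_add hr]; norm_num
  have e2 : (2 : ℝ) / (9 / 4 - 2) * (r ^ (-(4 : ℝ) / 3)) ^ ((2 : ℝ) - 9 / 4) = 8 * r ^ ((1 : ℝ) / 3) := by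
    rw [← Real.rpow_mul hr.le]; norm_num
  rw [e2, ENNReal.ofReal_mul (by norm_num : (0 : ℝ) ≤ 8)]
  calc ENNReal.ofReal (r ^ 3) * V1 * ENNReal.ofReal ((r ^ (-(4 : ℝ) / 3)) ^ (2 : ℝ)) +
        ENNReal.ofReal 8 * ENNReal.ofReal (r ^ ((1 : ℝ) / 3)) * W
      = V1 * (ENNReal.ofReal (r ^ 3) * ENNReal.ofReal ((r ^ (-(4 : ℝ) / 3)) ^ (2 : ℝ))) +
        ENNReal.ofReal 8 * W * ENNReal.ofReal (r ^ ((1 : ℝ) / 3)) := by ring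
    _ = (V1 + ENNReal.ofReal 8 * W) * ENNReal.ofReal (r ^ ((1 : ℝ) / 3)) := by
        rw [← ENNReal.ofReal_mul (by positivity), e1]; ring

/-- The Bernoulli function of a.e.-strongly measurable data is a.e.-strongly measurable. [folklore] -/
theorem aestronglyMeasurable_bern {v : E3 → E3} {q : E3 → ℝ} (hv : AEStronglyMeasurable v volume)
    (hq : AEStronglyMeasurable q volume) : AEStronglyMeasurable (bern v q) volume := by
  unfold bern
  exact (hq.aemeasurable.add ((hv.norm.aemeasurable.pow_const 2).div_const 2)).aestronglyMeasurable

/-! ## The velocity through the Bernoulli function: `|v|² = 2𝒬 − 2q` -/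

/-- `|v|² ≤ 2|𝒬| + 2|q|`, `𝒬 = q + |v|²/2`. [cite: Wu2026, 𝒬 = p + |v|²/2, p.23 l.53–55] -/
theorem norm_sq_le_two_abs_bern_add (v : E3 → E3) (q : E3 → ℝ) (x : E3) :
    ‖v x‖ ^ 2 ≤ 2 * |bern v q x| + 2 * |q x| := by
  have h : ‖v x‖ ^ 2 = 2 * bern v q x - 2 * q x := by unfold bern; ring
  rw [h]
  linarith [le_abs_self (bern v q x), neg_abs_le (q x)]

/-- `∫_{B̄_r}|v|² ≤ 2(∫_{B̄_r}|𝒬| + ∫_{B̄_r}|q|) ≤ K r^{5/3}` for `𝒬, q ∈ L^{9/4,∞}`. [cite: Wu2026, (3.17)/(3.41) p.9/p.15 (scaled form (3.75) p.24)] -/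
theorem setLIntegral_normSq_le_of_bern {v : E3 → E3} {q : E3 → ℝ}
    (hv : AEStronglyMeasurable v volume) (hq : AEStronglyMeasurable q volume) {r : ℝ} (hr : 0 < r) :
    ∫⁻ x in closedBall (0 : E3) r, ‖v x‖ₑ ^ (2 : ℝ) ≤
      2 * ((volume (ball (0 : E3) 1) +
          ENNReal.ofReal (4 / 5) * eWeakLpPow (bern v q) ((9 : ℝ≥0∞) / 4) volume) +
        (volume (ball (0 : E3) 1) + ENNReal.ofReal (4 / 5) * eWeakLpPow q ((9 : ℝ≥0∞) / 4) volume)) *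
        ENNReal.ofReal (r ^ ((5 : ℝ) / 3)) := by
  have hb : AEStronglyMeasurable (bern v q) volume := aestronglyMeasurable_bern hv hq
  have hpt : ∀ x, ‖v x‖ₑ ^ (2 : ℝ) ≤
      ENNReal.ofReal 2 * ‖bern v q x‖ₑ + ENNReal.ofReal 2 * ‖q x‖ₑ := by
    intro x
    have h1 : ‖v x‖ₑ ^ (2 : ℝ) = ENNReal.ofReal (‖v x‖ ^ 2) := by
      rw [← ofReal_norm, ENNReal.ofReal_rpow_of_nonneg (norm_nonneg _) (by norm_num : (0 : ℝ) ≤ 2),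
        Real.rpow_two]
    rw [h1, Real.enorm_eq_ofReal_abs, Real.enorm_eq_ofReal_abs,
      ← ENNReal.ofReal_mul (by norm_num), ← ENNReal.ofReal_mul (by norm_num),
      ← ENNReal.ofReal_add (by positivity) (by positivity)]
    exact ENNReal.ofReal_le_ofReal (norm_sq_le_two_abs_bern_add v q x)
  calc ∫⁻ x in closedBall (0 : E3) r, ‖v x‖ₑ ^ (2 : ℝ)
      ≤ ∫⁻ x in closedBall (0 : E3) r,
          (ENNReal.ofReal 2 * ‖bern v q x‖ₑ + ENNReal.ofReal 2 * ‖q x‖ₑ) := lintegral_mono fun x => hpt x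
    _ = ENNReal.ofReal 2 * (∫⁻ x in closedBall (0 : E3) r, ‖bern v q x‖ₑ) +
          ENNReal.ofReal 2 * ∫⁻ x in closedBall (0 : E3) r, ‖q x‖ₑ := by
        rw [lintegral_add_left' ((hb.enorm.restrict).const_mul _),
          lintegral_const_mul' _ _ ENNReal.ofReal_ne_top, lintegral_const_mul' _ _ ENNReal.ofReal_ne_top]
    _ ≤ ENNReal.ofReal 2 * ((volume (ball (0 : E3) 1) +
            ENNReal.ofReal (4 / 5) * eWeakLpPow (bern v q) ((9 : ℝ≥0∞) / 4) volume) *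
            ENNReal.ofReal (r ^ ((5 : ℝ) / 3))) +
          ENNReal.ofReal 2 * ((volume (ball (0 : E3) 1) +
            ENNReal.ofReal (4 / 5) * eWeakLpPow q ((9 : ℝ≥0∞) / 4) volume) *
            ENNReal.ofReal (r ^ ((5 : ℝ) / 3))) := by
        gcongr
        · exact setLIntegral_enorm_le_of_weak hb hr
        · exact setLIntegral_enorm_le_of_weak hq hr
    _ = _ := by
        rw [ENNReal.ofReal_ofNat]
        ring

/-! ## (3.73): the scale-invariant annular current bound, by Cauchy–Schwarz -/

/-- **(3.73), scale-invariant form**: for `𝒬, q ∈ L^{9/4,∞}` (weak quasinorms possibly infinite, in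
which case the bound is vacuous), `∫_{B̄_r} |𝒬||v| ≤ A · r` for every `r > 0`, with `A` the explicit
product of square roots below (Cauchy–Schwarz on `B̄_r`: `(K'r^{1/3})^{1/2}(K r^{5/3})^{1/2} = A r`).
[cite: Wu2026, (3.73) p.24 l.1–11] -/
theorem setLIntegral_bern_mul_norm_le {v : E3 → E3} {q : E3 → ℝ}
    (hv : AEStronglyMeasurable v volume) (hq : AEStronglyMeasurable q volume) {r : ℝ} (hr : 0 < r) :
    ∫⁻ x in closedBall (0 : E3) r, ‖bern v q x‖ₑ * ‖v x‖ₑ ≤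
      ((volume (ball (0 : E3) 1) + ENNReal.ofReal 8 * eWeakLpPow (bern v q) ((9 : ℝ≥0∞) / 4) volume) ^
          (1 / 2 : ℝ) *
        (2 * ((volume (ball (0 : E3) 1) +
            ENNReal.ofReal (4 / 5) * eWeakLpPow (bern v q) ((9 : ℝ≥0∞) / 4) volume) +
          (volume (ball (0 : E3) 1) +
            ENNReal.ofReal (4 / 5) * eWeakLpPow q ((9 : ℝ≥0∞) / 4) volume))) ^ (1 / 2 : ℝ)) *
      ENNReal.ofReal r := by
  have hb : AEStronglyMeasurable (bern v q) volume := aestronglyMeasurable_bern hv hq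
  set K1 : ℝ≥0∞ := volume (ball (0 : E3) 1) +
    ENNReal.ofReal 8 * eWeakLpPow (bern v q) ((9 : ℝ≥0∞) / 4) volume with hK1
  set K2 : ℝ≥0∞ := 2 * ((volume (ball (0 : E3) 1) +
      ENNReal.ofReal (4 / 5) * eWeakLpPow (bern v q) ((9 : ℝ≥0∞) / 4) volume) +
    (volume (ball (0 : E3) 1) + ENNReal.ofReal (4 / 5) * eWeakLpPow q ((9 : ℝ≥0∞) / 4) volume))
    with hK2
  have hpq : (2 : ℝ).HolderConjugate 2 := by
    rw [Real.holderConjugate_iff_eq_conjExponent one_lt_two]; norm_num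
  have hcs := ENNReal.lintegral_mul_le_Lp_mul_Lq (volume.restrict (closedBall (0 : E3) r)) hpq
    hb.enorm.restrict hv.enorm.restrict
  simp only [Pi.mul_apply] at hcs
  have h1 := setLIntegral_enorm_sq_le_of_weak hb hr
  have h2 := setLIntegral_normSq_le_of_bern hv hq hr
  rw [← hK1] at h1
  rw [← hK2] at h2
  calc ∫⁻ x in closedBall (0 : E3) r, ‖bern v q x‖ₑ * ‖v x‖ₑ
      ≤ (∫⁻ x in closedBall (0 : E3) r, ‖bern v q x‖ₑ ^ (2 : ℝ)) ^ (1 / (2 : ℝ)) *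
          (∫⁻ x in closedBall (0 : E3) r, ‖v x‖ₑ ^ (2 : ℝ)) ^ (1 / (2 : ℝ)) := hcs
    _ ≤ (K1 * ENNReal.ofReal (r ^ ((1 : ℝ) / 3))) ^ (1 / (2 : ℝ)) *
          (K2 * ENNReal.ofReal (r ^ ((5 : ℝ) / 3))) ^ (1 / (2 : ℝ)) := by gcongr
    _ = K1 ^ (1 / 2 : ℝ) * K2 ^ (1 / 2 : ℝ) * ENNReal.ofReal r := by
        rw [ENNReal.mul_rpow_of_nonneg _ _ (by norm_num), ENNReal.mul_rpow_of_nonneg _ _ (by norm_num),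
          ENNReal.ofReal_rpow_of_nonneg (by positivity) (by norm_num),
          ENNReal.ofReal_rpow_of_nonneg (by positivity) (by norm_num), ← Real.rpow_mul hr.le,
          ← Real.rpow_mul hr.le]
        have e : ENNReal.ofReal (r ^ ((1 : ℝ) / 3 * (1 / 2))) * ENNReal.ofReal (r ^ ((5 : ℝ) / 3 * (1 / 2))) =
            ENNReal.ofReal r := by
          rw [← ENNReal.ofReal_mul (by positivity), ← Real.rpow_add hr]
          norm_num
        calc K1 ^ (1 / 2 : ℝ) * ENNReal.ofReal (r ^ ((1 : ℝ) / 3 * (1 / 2))) *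
              (K2 ^ (1 / 2 : ℝ) * ENNReal.ofReal (r ^ ((5 : ℝ) / 3 * (1 / 2))))
            = K1 ^ (1 / 2 : ℝ) * K2 ^ (1 / 2 : ℝ) *
              (ENNReal.ofReal (r ^ ((1 : ℝ) / 3 * (1 / 2))) * ENNReal.ofReal (r ^ ((5 : ℝ) / 3 * (1 / 2)))) := by
                ring
          _ = _ := by rw [e]

/-! ## (3.74): the quantitative shell lemma -/

/-- **Quantitative shell lemma** (the dyadic summation of (3.74)/(3.78) p.24: «the contribution of
`A_{2^kL}` is bounded by `(2^kL)^{−2}·C(2^kL) = C(2^kL)^{−1}`»): if `∫_{B̄_r} F ≤ A·r` for every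
`r > 0`, then `∫_{|x|>ρ} F|x|^{−2} ≤ 4A/ρ` for every `ρ > 0` (shells `2^kρ ≤ |x| < 2^{k+1}ρ`,
`Σ_k 2·2^{−k} = 4`). [cite: Wu2026, (3.74)/(3.78) p.24] -/
theorem lintegral_exterior_mul_inv_sq_le {F : E3 → ℝ≥0∞} {A : ℝ≥0∞}
    (hballs : ∀ r : ℝ, 0 < r → ∫⁻ x in closedBall (0 : E3) r, F x ≤ A * ENNReal.ofReal r)
    {ρ : ℝ} (hρ : 0 < ρ) :
    ∫⁻ x in {x : E3 | ρ < ‖x‖}, F x * ENNReal.ofReal (‖x‖ ^ (-(2 : ℝ))) ≤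
      A * ENNReal.ofReal (4 / ρ) := by
  set S : ℕ → Set E3 := fun k => {x | 2 ^ k * ρ ≤ ‖x‖ ∧ ‖x‖ < 2 ^ (k + 1) * ρ} with hS
  have hcover : {x : E3 | ρ < ‖x‖} ⊆ ⋃ k, S k := by
    intro x hx
    have hx' : 1 ≤ ‖x‖ / ρ := by rw [le_div_iff₀ hρ, one_mul]; exact le_of_lt hx
    obtain ⟨n, hn1, hn2⟩ := exists_nat_pow_near hx' one_lt_two
    refine mem_iUnion.2 ⟨n, ?_, ?_⟩
    · rwa [le_div_iff₀ hρ] at hn1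
    · rwa [div_lt_iff₀ hρ] at hn2
  have hSm : ∀ k, MeasurableSet (S k) := fun k =>
    (measurableSet_le measurable_const measurable_norm).inter
      (measurableSet_lt measurable_norm measurable_const)
  -- the shell bound `∫_{S_k} F|x|⁻² ≤ A · (2/ρ) · (1/2)^k`
  have hshell : ∀ k : ℕ, ∫⁻ x in S k, F x * ENNReal.ofReal (‖x‖ ^ (-(2 : ℝ))) ≤
      A * ENNReal.ofReal (2 / ρ) * (2⁻¹) ^ k := by
    intro k
    have h2k : (0 : ℝ) < 2 ^ k * ρ := by positivity
    have hwk : ∀ x ∈ S k, F x * ENNReal.ofReal (‖x‖ ^ (-(2 : ℝ))) ≤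
        F x * ENNReal.ofReal ((2 ^ k * ρ) ^ (-(2 : ℝ))) := fun x hx =>
      mul_le_mul' le_rfl (ENNReal.ofReal_le_ofReal
        (Real.rpow_le_rpow_of_nonpos h2k hx.1 (by norm_num)))
    have hsub : S k ⊆ closedBall (0 : E3) (2 ^ (k + 1) * ρ) := fun x hx => by
      rw [mem_closedBall, dist_zero_right]; exact hx.2.le
    calc ∫⁻ x in S k, F x * ENNReal.ofReal (‖x‖ ^ (-(2 : ℝ)))
        ≤ ∫⁻ x in S k, F x * ENNReal.ofReal ((2 ^ k * ρ) ^ (-(2 : ℝ))) := setLIntegral_mono' (hSm k) hwk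
      _ = (∫⁻ x in S k, F x) * ENNReal.ofReal ((2 ^ k * ρ) ^ (-(2 : ℝ))) :=
          lintegral_mul_const' _ _ ENNReal.ofReal_ne_top
      _ ≤ (∫⁻ x in closedBall (0 : E3) (2 ^ (k + 1) * ρ), F x) *
            ENNReal.ofReal ((2 ^ k * ρ) ^ (-(2 : ℝ))) :=
          mul_le_mul' (lintegral_mono_set hsub) le_rfl
      _ ≤ A * ENNReal.ofReal (2 ^ (k + 1) * ρ) * ENNReal.ofReal ((2 ^ k * ρ) ^ (-(2 : ℝ))) := by
          gcongr; exact hballs _ (by positivity)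
      _ = A * ENNReal.ofReal (2 / ρ) * (2⁻¹) ^ k := by
          rw [mul_assoc, mul_assoc, ← ENNReal.ofReal_mul (by positivity), ← ENNReal.inv_pow,
            ← ENNReal.ofReal_ofNat 2, ← ENNReal.ofReal_pow (by norm_num), ← ENNReal.ofReal_inv_of_pos
            (by positivity), ← ENNReal.ofReal_mul (by positivity)]
          congr 2
          rw [Real.rpow_neg h2k.le, show ((2 : ℝ) ^ k * ρ) ^ (2 : ℝ) = (2 ^ k * ρ) ^ (2 : ℕ) from by
            rw [← Real.rpow_natCast]; norm_num]
          field_simp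
          ring
  calc ∫⁻ x in {x : E3 | ρ < ‖x‖}, F x * ENNReal.ofReal (‖x‖ ^ (-(2 : ℝ)))
      ≤ ∫⁻ x in ⋃ k, S k, F x * ENNReal.ofReal (‖x‖ ^ (-(2 : ℝ))) := lintegral_mono_set hcover
    _ ≤ ∑' k, ∫⁻ x in S k, F x * ENNReal.ofReal (‖x‖ ^ (-(2 : ℝ))) := lintegral_iUnion_le _ _
    _ ≤ ∑' k : ℕ, A * ENNReal.ofReal (2 / ρ) * (2⁻¹) ^ k := ENNReal.tsum_le_tsum hshell
    _ = A * ENNReal.ofReal (2 / ρ) * (1 - 2⁻¹)⁻¹ := by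
        rw [ENNReal.tsum_mul_left, ENNReal.tsum_geometric]
    _ = A * ENNReal.ofReal (4 / ρ) := by
        rw [ENNReal.one_sub_inv_two, inv_inv, mul_assoc, ← ENNReal.ofReal_ofNat 2,
          ← ENNReal.ofReal_mul (by positivity)]
        congr 2
        ring

/-! ## (3.74) uniformly in the radius, and the uniform Abel tail (3.78) -/

/-- The pointwise size of the current: `|𝒬 v·x/|x|³| ≤ |𝒬||v||x|⁻²`. [cite: Wu2026, (3.73)–(3.74) p.24] -/
theorem abs_current_le_abs_bern_mul (v : E3 → E3) (q : E3 → ℝ) (x : E3) :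
    |bern v q x * ⟪v x, x⟫ / ‖x‖ ^ 3| ≤ |bern v q x| * ‖v x‖ * ‖x‖ ^ (-(2 : ℝ)) := by
  by_cases hx : x = 0
  · subst hx
    rw [norm_zero, zero_pow three_ne_zero, div_zero, abs_zero]
    positivity
  have hx0 : 0 < ‖x‖ := norm_pos_iff.2 hx
  rw [abs_div, abs_mul, abs_of_pos (pow_pos hx0 3), Real.rpow_neg hx0.le,
    show ‖x‖ ^ (2 : ℝ) = ‖x‖ ^ (2 : ℕ) from by rw [← Real.rpow_natCast]; norm_num]
  have hin : |⟪v x, x⟫| ≤ ‖v x‖ * ‖x‖ := abs_real_inner_le_norm _ _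
  rw [div_le_iff₀ (pow_pos hx0 3)]
  calc |bern v q x| * |⟪v x, x⟫| ≤ |bern v q x| * (‖v x‖ * ‖x‖) := by gcongr
    _ = |bern v q x| * ‖v x‖ * (‖x‖ ^ 2)⁻¹ * ‖x‖ ^ 3 := by field_simp

/-- The `ℝ≥0∞` form of the integrand `|𝒬||v||x|⁻²`. [folklore] -/
theorem ofReal_abs_bern_mul_norm_mul (v : E3 → E3) (q : E3 → ℝ) (x : E3) :
    ENNReal.ofReal (|bern v q x| * ‖v x‖ * ‖x‖ ^ (-(2 : ℝ))) =
      ‖bern v q x‖ₑ * ‖v x‖ₑ * ENNReal.ofReal (‖x‖ ^ (-(2 : ℝ))) := by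
  rw [ENNReal.ofReal_mul (by positivity), ENNReal.ofReal_mul (abs_nonneg _),
    ← Real.enorm_eq_ofReal_abs, ofReal_norm]

/-- **(3.74), uniformly in the radius**: for `q ∈ L^{9/4,∞}`, `𝒬 = q + |v|²/2 ∈ L^{9/4,∞}` there is a
finite `C` with `∫_{|x|>ρ} |𝒬||v||x|⁻² ≤ C/ρ` for EVERY `ρ > 0` (the print's `R∫_{|x|>R}|𝒬v|/|x|² ≤ C`
with the scale-invariant constant). [cite: Wu2026, (3.73)–(3.74) p.24 l.1–31] -/
theorem exists_physical_tail_le {v : E3 → E3} {q : E3 → ℝ} (hv : AEStronglyMeasurable v volume)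
    (hq : MemWeakLp q ((9 : ℝ≥0∞) / 4) volume)
    (hb : MemWeakLp (bern v q) ((9 : ℝ≥0∞) / 4) volume) :
    ∃ C : ℝ≥0∞, C ≠ ∞ ∧ ∀ ρ : ℝ, 0 < ρ →
      ∫⁻ x in {x : E3 | ρ < ‖x‖}, ENNReal.ofReal (|bern v q x| * ‖v x‖ * ‖x‖ ^ (-(2 : ℝ))) ≤
        C * ENNReal.ofReal ρ⁻¹ := by
  set V1 : ℝ≥0∞ := volume (ball (0 : E3) 1) with hV1
  have hV1t : V1 ≠ ∞ := measure_ball_lt_top.ne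
  set Wb : ℝ≥0∞ := eWeakLpPow (bern v q) ((9 : ℝ≥0∞) / 4) volume with hWb
  set Wq : ℝ≥0∞ := eWeakLpPow q ((9 : ℝ≥0∞) / 4) volume with hWq
  have hWbt : Wb ≠ ∞ := hb.eWeakLpPow_lt_top.ne
  have hWqt : Wq ≠ ∞ := hq.eWeakLpPow_lt_top.ne
  set A : ℝ≥0∞ := (V1 + ENNReal.ofReal 8 * Wb) ^ (1 / 2 : ℝ) *
    (2 * ((V1 + ENNReal.ofReal (4 / 5) * Wb) + (V1 + ENNReal.ofReal (4 / 5) * Wq))) ^ (1 / 2 : ℝ)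
    with hA
  have hAt : A ≠ ∞ := by
    refine ENNReal.mul_ne_top (ENNReal.rpow_ne_top_of_nonneg (by norm_num) ?_)
      (ENNReal.rpow_ne_top_of_nonneg (by norm_num) ?_)
    · exact ENNReal.add_ne_top.2 ⟨hV1t, ENNReal.mul_ne_top ENNReal.ofReal_ne_top hWbt⟩
    · refine ENNReal.mul_ne_top (by norm_num) (ENNReal.add_ne_top.2 ⟨?_, ?_⟩)
      · exact ENNReal.add_ne_top.2 ⟨hV1t, ENNReal.mul_ne_top ENNReal.ofReal_ne_top hWbt⟩
      · exact ENNReal.add_ne_top.2 ⟨hV1t, ENNReal.mul_ne_top ENNReal.ofReal_ne_top hWqt⟩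
  refine ⟨A * 4, ENNReal.mul_ne_top hAt (by norm_num), fun ρ hρ => ?_⟩
  have hballs : ∀ r : ℝ, 0 < r →
      ∫⁻ x in closedBall (0 : E3) r, ‖bern v q x‖ₑ * ‖v x‖ₑ ≤ A * ENNReal.ofReal r := by
    intro r hr
    have h := setLIntegral_bern_mul_norm_le hv hq.1 hr
    rwa [← hV1, ← hWb, ← hWq, ← hA] at h
  have h := lintegral_exterior_mul_inv_sq_le hballs hρ
  calc ∫⁻ x in {x : E3 | ρ < ‖x‖}, ENNReal.ofReal (|bern v q x| * ‖v x‖ * ‖x‖ ^ (-(2 : ℝ)))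
      = ∫⁻ x in {x : E3 | ρ < ‖x‖}, ‖bern v q x‖ₑ * ‖v x‖ₑ * ENNReal.ofReal (‖x‖ ^ (-(2 : ℝ))) :=
        lintegral_congr fun x => ofReal_abs_bern_mul_norm_mul v q x
    _ ≤ A * ENNReal.ofReal (4 / ρ) := h
    _ = A * 4 * ENNReal.ofReal ρ⁻¹ := by
        rw [div_eq_mul_inv, ENNReal.ofReal_mul (by norm_num), ENNReal.ofReal_ofNat]
        ring

/-- **(3.78), the uniform Abel tail**: for `q ∈ L^{9/4,∞}`, `𝒬 ∈ L^{9/4,∞}` there is a finite `C`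
with `∫_{|y|>L} |Q_R(y)||V_R(y)||y|⁻² dy ≤ C/L` for EVERY `R > 0` and `L > 0`, `V_R = R^{2/3}v(R·)`,
`P_R = R^{4/3}q(R·)`, `Q_R = P_R + |V_R|²/2` («sup_j ∫_{|y|>L}|Q_jV_j|/|y|² ≤ C/L … This estimate is
the step that permits passage to the noncompact integral»). [cite: Wu2026, (3.75)–(3.78) p.24 l.32–90] -/
theorem exists_rescaled_tail_le {v : E3 → E3} {q : E3 → ℝ} (hv : AEStronglyMeasurable v volume)
    (hq : MemWeakLp q ((9 : ℝ≥0∞) / 4) volume)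
    (hb : MemWeakLp (bern v q) ((9 : ℝ≥0∞) / 4) volume) :
    ∃ C : ℝ≥0∞, C ≠ ∞ ∧ ∀ R : ℝ, 0 < R → ∀ L : ℝ, 0 < L →
      ∫⁻ y in {y : E3 | L < ‖y‖}, ENNReal.ofReal
          (|bern (blowDown R v) (blowDownP R q) y| * ‖blowDown R v y‖ * ‖y‖ ^ (-(2 : ℝ))) ≤
        C * ENNReal.ofReal L⁻¹ := by
  obtain ⟨C, hCt, hC⟩ := exists_physical_tail_le hv hq hb
  refine ⟨C, hCt, fun R hR L hL => ?_⟩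
  rw [lintegral_tail_blowDown hR L v q]
  calc ENNReal.ofReal R * ∫⁻ x in {x : E3 | R * L < ‖x‖},
          ENNReal.ofReal (|bern v q x| * ‖v x‖ * ‖x‖ ^ (-(2 : ℝ)))
      ≤ ENNReal.ofReal R * (C * ENNReal.ofReal (R * L)⁻¹) :=
        mul_le_mul' le_rfl (hC (R * L) (mul_pos hR hL))
    _ = C * ENNReal.ofReal L⁻¹ := by
        rw [mul_inv, ENNReal.ofReal_mul (inv_nonneg.2 hR.le), ← mul_assoc, ← mul_assoc,
          mul_comm (ENNReal.ofReal R) C, mul_assoc C, ← ENNReal.ofReal_mul hR.le,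
          mul_inv_cancel₀ hR.ne', ENNReal.ofReal_one, mul_one]

end Summit.NavierStokesRegularity.NavierStokesRegularity.Theorems.Wu2026Salvage

end

-- WHAT THIS IS NOT: not a claim about NS regularity or blow-up; not a claim about any author beyond the typed locator.
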